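import Literature.AlgebraicGeometry.Motives.FamiliesVHSTensorMorphism
import Literature.AlgebraicGeometry.Motives.FamiliesVHSTateTwist
import Literature.AlgebraicGeometry.Motives.FamiliesVHSProdMorphism
import HarnessLib

/-!
# Isomorphisms of VHS data: invariance of integral Hodge classes and Hodge loci, isometries and the norm-bounded Hodge loci, functoriality

Topic `Literature/AlgebraicGeometry/Motives` (namespace `Literature.AlgebraicGeometry.Motives.VHSData`), lane `lit-hodgefound` (seat `p08`, row g57-#7).
DEFINITIONS WITH BODIES (`VHSData.Iso` with `refl ∕ symm ∕ trans ∕ toLinearEquiv`, the predicate `VHSData.Hom.IsIsometry`, and the isomorphisms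
`Iso.tensor ∕ dual ∕ tateTwist ∕ castMap ∕ prod ∕ tateTwistZero ∕ tateTwistAdd`) and their API; no named fact, no instance, no notation (D-0026 net debt `0`).
Sequel of `Motives/FamiliesVHSMorphism` (`VHSData.Hom`), `Motives/FamiliesVHSTensorMorphism` (`φ ⊗ ψ`, `φ^∨`, `castMap`), `Motives/FamiliesVHSTateTwist`
(`φ(j)`, `D(0) ≅ D`, `D(i)(j) ≅ D(i+j)`), `Motives/FamiliesVHSProdMorphism` (`φ ⊕ ψ`).

PRINTED SOURCES.  C. Voisin, *Hodge theory and complex algebraic geometry I*, §7.3.1 (morphisms of variations of Hodge structure: flat maps of local systems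
that are morphisms of Hodge structures fibrewise) and II, §5.3 (Hodge loci are functorial).  W. Schmid, *Variation of Hodge structure*, Invent. Math. 22
(1973), §2.  E. Cattani, P. Deligne, A. Kaplan, *On the locus of Hodge classes*, J. AMS 8 (1995), §1, Thm 1.1: the locus `S^{(K)}` of Hodge classes `u`
with `Q(u, u) ≤ K` — visibly invariant under isomorphisms of polarized variations respecting `Q`.  P. Deligne, J. Milne, *Tannakian categories*, LNM 900
(1982), §1 (the constraints of a tensor category are isomorphisms, functorial in each variable).  P. Deligne, *Équations différentielles à points singuliers
réguliers*, LNM 163 (1970), I.1.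

* §0 rationalizations of identities and composites (`Hom.appRat_id`, `Hom.appRat_comp`), `Hom.castMap_id ∕ castMap_comp`.
* §1 **`VHSData.Iso D₁ D₂`**: a pair of morphisms `hom : D₁ → D₂`, `inv : D₂ → D₁` with `inv ∘ hom = id`, `hom ∘ inv = id`; `refl`, `symm`, `trans`, the
  lattice isomorphisms `toLinearEquiv s : V₁,ℤ,s ≃ V₂,ℤ,s`, pointwise and rational inverse identities, injectivity.
* §2 **invariance of Hodge classes and loci**: `isHodgeAt_hom_app_iff` (`hom u` is Hodge of level `p` iff `u` is), its transported form, and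
  **`setOf_exists_isHodgeAt_transport_eq`** (the flat-transport Hodge loci of `u` and `hom u` coincide).
* §3 **isometries** `Hom.IsIsometry φ` (`Q₂(φ x, φ y) = Q₁(x, y)` on rational fibres): stable under `id`, composition, inverses of isomorphisms; an
  injective isometry maps `hodgeLocusOfNormLe` into `hodgeLocusOfNormLe` and an isometric isomorphism identifies them (**`Iso.hodgeLocusOfNormLe_eq`**).
* §4 **functoriality**: `Iso.tensor`, `Iso.dual`, `Iso.tateTwist`, `Iso.castMap`, `Iso.prod`, and the structural isomorphisms `Iso.tateTwistZero : D(0) ≅ D`,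
  `Iso.tateTwistAdd : D(i)(j) ≅ D(i+j)` of `Motives/FamiliesVHSTateTwist` packaged.

HONEST SCOPE: as for every `VHSData`, holomorphy ∕ transversality are not recorded; `Iso` does not require compatibility with the polarizations (that is
the separate predicate `IsIsometry`, needed exactly for the norm-bounded loci).

## References

* [VoisinHodgeI2002] C. Voisin, *Hodge Theory and Complex Algebraic Geometry I*, CUP 2002, §7.3.1.
* [Schmid1973] W. Schmid, *Variation of Hodge structure: the singularities of the period mapping*, Invent. Math. 22 (1973), §2.
* [CattaniDeligneKaplan1995] E. Cattani, P. Deligne, A. Kaplan, *On the locus of Hodge classes*, J. Amer. Math. Soc. 8 (1995), §1, Thm 1.1.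
* [DeligneMilne1982Tannakian] P. Deligne, J. S. Milne, *Tannakian categories*, in LNM 900 (1982), §1.
* [DeligneHodgeII1971] P. Deligne, *Théorie de Hodge II*, Publ. Math. IHÉS 40 (1971), 2.1.14.
* [Deligne1970] P. Deligne, *Équations différentielles à points singuliers réguliers*, LNM 163 (1970), I.1.
-/

noncomputable section

open CategoryTheory
open scoped TensorProduct

namespace Literature.AlgebraicGeometry.Motives

namespace VHSData

variable {S : Type} [TopologicalSpace S] {k k' : ℤ}

/-! ## §0 Rationalizations of identities and composites; `castMap` is functorial -/

section Hom

variable {D₁ D₂ D₃ : VHSData S k}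

/-- `(id_D)_ℚ = id`. [cite: Schmid1973, §2] -/
theorem Hom.appRat_id (D : VHSData S k) (s : S) : (Hom.id D).appRat s = LinearMap.id :=
  D.homRat_id s

/-- `(ψ ∘ φ)_ℚ = ψ_ℚ ∘ φ_ℚ`. [cite: Schmid1973, §2] -/
theorem Hom.appRat_comp (ψ : Hom D₂ D₃) (φ : Hom D₁ D₂) (s : S) : (ψ.comp φ).appRat s = ψ.appRat s ∘ₗ φ.appRat s :=
  D₁.homRat_comp D₂ D₃ s (φ.app s) (ψ.app s)

/-- `castMap` of the identity is the identity. [cite: DeligneHodgeII1971, 2.1.14] -/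
theorem Hom.castMap_id (D : VHSData S k) (h : k = k') : (Hom.id D).castMap h = Hom.id (D.cast h) :=
  Hom.ext_of_app _ _ fun _ => rfl

/-- `castMap` of a composite is the composite of the `castMap`s. [cite: DeligneHodgeII1971, 2.1.14] -/
theorem Hom.castMap_comp (ψ : Hom D₂ D₃) (φ : Hom D₁ D₂) (h : k = k') : (ψ.comp φ).castMap h = (ψ.castMap h).comp (φ.castMap h) :=
  Hom.ext_of_app _ _ fun _ => rfl

end Hom

/-! ## §1 Isomorphisms of VHS data -/

/-- **An isomorphism of VHS data** `D₁ ≅ D₂` (same base, same weight): morphisms `hom : D₁ → D₂` and `inv : D₂ → D₁` of VHS data (flat families of lattice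
maps, Hodge fibrewise) with `inv ∘ hom = id` and `hom ∘ inv = id`.  Compatibility with the polarizations is NOT part of the structure (see `Hom.IsIsometry`).
[cite: VoisinHodgeI2002, §7.3.1] [cite: Schmid1973, §2] -/
structure Iso (D₁ D₂ : VHSData S k) where
  /-- The forward morphism. -/
  hom : Hom D₁ D₂
  /-- The backward morphism. -/
  inv : Hom D₂ D₁
  /-- `inv ∘ hom = id`. -/
  inv_comp_hom : inv.comp hom = Hom.id D₁
  /-- `hom ∘ inv = id`. -/
  hom_comp_inv : hom.comp inv = Hom.id D₂

namespace Iso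

variable {D₁ D₂ D₃ : VHSData S k}

/-- `inv_s (hom_s u) = u` on lattices. [cite: VoisinHodgeI2002, §7.3.1] -/
@[simp] theorem inv_app_hom_app (e : Iso D₁ D₂) (s : S) (u : D₁.VZ.fiber s) : e.inv.app s (e.hom.app s u) = u :=
  congrArg (fun χ : Hom D₁ D₁ => χ.app s u) e.inv_comp_hom

/-- `hom_s (inv_s v) = v` on lattices. [cite: VoisinHodgeI2002, §7.3.1] -/
@[simp] theorem hom_app_inv_app (e : Iso D₁ D₂) (s : S) (v : D₂.VZ.fiber s) : e.hom.app s (e.inv.app s v) = v :=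
  congrArg (fun χ : Hom D₂ D₂ => χ.app s v) e.hom_comp_inv

/-- `inv_s ∘ hom_s = id`. [cite: VoisinHodgeI2002, §7.3.1] -/
theorem inv_app_comp_hom_app (e : Iso D₁ D₂) (s : S) : e.inv.app s ∘ₗ e.hom.app s = LinearMap.id :=
  LinearMap.ext (e.inv_app_hom_app s)

/-- `hom_s ∘ inv_s = id`. [cite: VoisinHodgeI2002, §7.3.1] -/
theorem hom_app_comp_inv_app (e : Iso D₁ D₂) (s : S) : e.hom.app s ∘ₗ e.inv.app s = LinearMap.id :=
  LinearMap.ext (e.hom_app_inv_app s)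

/-- **The identity isomorphism.** [cite: VoisinHodgeI2002, §7.3.1] -/
def refl (D : VHSData S k) : Iso D D where
  hom := Hom.id D
  inv := Hom.id D
  inv_comp_hom := Hom.ext_of_app _ _ fun _ => LinearMap.ext fun _ => rfl
  hom_comp_inv := Hom.ext_of_app _ _ fun _ => LinearMap.ext fun _ => rfl

/-- **The inverse isomorphism.** [cite: VoisinHodgeI2002, §7.3.1] -/
def symm (e : Iso D₁ D₂) : Iso D₂ D₁ where
  hom := e.inv
  inv := e.hom
  inv_comp_hom := e.hom_comp_inv
  hom_comp_inv := e.inv_comp_hom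

/-- **Composition of isomorphisms.** [cite: VoisinHodgeI2002, §7.3.1] -/
def trans (e₁ : Iso D₁ D₂) (e₂ : Iso D₂ D₃) : Iso D₁ D₃ where
  hom := e₂.hom.comp e₁.hom
  inv := e₁.inv.comp e₂.inv
  inv_comp_hom := Hom.ext_of_app _ _ fun s => LinearMap.ext fun u => by
    change e₁.inv.app s (e₂.inv.app s (e₂.hom.app s (e₁.hom.app s u))) = u
    rw [e₂.inv_app_hom_app, e₁.inv_app_hom_app]
  hom_comp_inv := Hom.ext_of_app _ _ fun s => LinearMap.ext fun v => by
    change e₂.hom.app s (e₁.hom.app s (e₁.inv.app s (e₂.inv.app s v))) = v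
    rw [e₁.hom_app_inv_app, e₂.hom_app_inv_app]

/-- `refl`, `symm`, `trans` on the forward morphism. [cite: VoisinHodgeI2002, §7.3.1] -/
@[simp] theorem refl_hom (D : VHSData S k) : (refl D).hom = Hom.id D := rfl

/-- The forward morphism of `symm` is the backward morphism. [cite: VoisinHodgeI2002, §7.3.1] -/
@[simp] theorem symm_hom (e : Iso D₁ D₂) : e.symm.hom = e.inv := rfl

/-- The backward morphism of `symm` is the forward morphism. [cite: VoisinHodgeI2002, §7.3.1] -/
@[simp] theorem symm_inv (e : Iso D₁ D₂) : e.symm.inv = e.hom := rfl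

/-- The forward morphism of `trans` is the composite. [cite: VoisinHodgeI2002, §7.3.1] -/
@[simp] theorem trans_hom (e₁ : Iso D₁ D₂) (e₂ : Iso D₂ D₃) : (e₁.trans e₂).hom = e₂.hom.comp e₁.hom := rfl

/-- The backward morphism of `trans` is the composite of the backward morphisms. [cite: VoisinHodgeI2002, §7.3.1] -/
@[simp] theorem trans_inv (e₁ : Iso D₁ D₂) (e₂ : Iso D₂ D₃) : (e₁.trans e₂).inv = e₁.inv.comp e₂.inv := rfl

/-- **The lattice isomorphism `V₁,ℤ,s ≃ V₂,ℤ,s` at `s`** underlying an isomorphism of VHS data. [cite: VoisinHodgeI2002, §7.3.1] [cite: Deligne1970, I.1] -/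
def toLinearEquiv (e : Iso D₁ D₂) (s : S) : D₁.VZ.fiber s ≃ₗ[ℤ] D₂.VZ.fiber s :=
  LinearEquiv.ofLinear (e.hom.app s) (e.inv.app s) (e.hom_app_comp_inv_app s) (e.inv_app_comp_hom_app s)

/-- `toLinearEquiv` is `hom_s`. [cite: VoisinHodgeI2002, §7.3.1] -/
@[simp] theorem toLinearEquiv_apply (e : Iso D₁ D₂) (s : S) (u : D₁.VZ.fiber s) : e.toLinearEquiv s u = e.hom.app s u := rfl

/-- `toLinearEquiv⁻¹` is `inv_s`. [cite: VoisinHodgeI2002, §7.3.1] -/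
@[simp] theorem toLinearEquiv_symm_apply (e : Iso D₁ D₂) (s : S) (v : D₂.VZ.fiber s) : (e.toLinearEquiv s).symm v = e.inv.app s v := rfl

/-- `hom_s` is injective. [cite: VoisinHodgeI2002, §7.3.1] -/
theorem hom_app_injective (e : Iso D₁ D₂) (s : S) : Function.Injective (e.hom.app s) :=
  (e.toLinearEquiv s).injective

/-- `hom_s` is bijective. [cite: VoisinHodgeI2002, §7.3.1] -/
theorem hom_app_bijective (e : Iso D₁ D₂) (s : S) : Function.Bijective (e.hom.app s) :=
  (e.toLinearEquiv s).bijective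

/-- `hom_s u = 0 ↔ u = 0`. [cite: VoisinHodgeI2002, §7.3.1] -/
theorem hom_app_eq_zero_iff (e : Iso D₁ D₂) (s : S) (u : D₁.VZ.fiber s) : e.hom.app s u = 0 ↔ u = 0 :=
  (e.toLinearEquiv s).map_eq_zero_iff

/-- `inv_ℚ ∘ hom_ℚ = id` on rational fibres. [cite: Schmid1973, §2] -/
theorem inv_appRat_comp_hom_appRat (e : Iso D₁ D₂) (s : S) : e.inv.appRat s ∘ₗ e.hom.appRat s = LinearMap.id := by
  rw [← Hom.appRat_comp, e.inv_comp_hom, Hom.appRat_id]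

/-- `hom_ℚ ∘ inv_ℚ = id` on rational fibres. [cite: Schmid1973, §2] -/
theorem hom_appRat_comp_inv_appRat (e : Iso D₁ D₂) (s : S) : e.hom.appRat s ∘ₗ e.inv.appRat s = LinearMap.id := by
  rw [← Hom.appRat_comp, e.hom_comp_inv, Hom.appRat_id]

/-- `inv_ℚ (hom_ℚ x) = x`. [cite: Schmid1973, §2] -/
@[simp] theorem inv_appRat_hom_appRat (e : Iso D₁ D₂) (s : S) (x : D₁.V.fiber s) : e.inv.appRat s (e.hom.appRat s x) = x := by
  rw [← LinearMap.comp_apply, e.inv_appRat_comp_hom_appRat, LinearMap.id_apply]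

/-- `hom_ℚ (inv_ℚ y) = y`. [cite: Schmid1973, §2] -/
@[simp] theorem hom_appRat_inv_appRat (e : Iso D₁ D₂) (s : S) (y : D₂.V.fiber s) : e.hom.appRat s (e.inv.appRat s y) = y := by
  rw [← LinearMap.comp_apply, e.hom_appRat_comp_inv_appRat, LinearMap.id_apply]

/-! ## §2 Invariance of integral Hodge classes and of Hodge loci -/

/-- **`hom_s u` is a Hodge class of level `p` iff `u` is** (both `hom` and `inv` preserve Hodge classes). [cite: VoisinHodgeI2002, §7.3.1 and Lemma 7.25]
[cite: CattaniDeligneKaplan1995, §1] -/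
theorem isHodgeAt_hom_app_iff (e : Iso D₁ D₂) (s : S) (p : ℤ) (u : D₁.VZ.fiber s) : D₂.IsHodgeAt s p (e.hom.app s u) ↔ D₁.IsHodgeAt s p u :=
  ⟨fun h => by
    have h' := e.inv.isHodgeAt_app h
    rwa [inv_app_hom_app] at h', fun h => e.hom.isHodgeAt_app h⟩

/-- `inv_s v` is a Hodge class of level `p` iff `v` is. [cite: VoisinHodgeI2002, §7.3.1 and Lemma 7.25] -/
theorem isHodgeAt_inv_app_iff (e : Iso D₁ D₂) (s : S) (p : ℤ) (v : D₂.VZ.fiber s) : D₁.IsHodgeAt s p (e.inv.app s v) ↔ D₂.IsHodgeAt s p v :=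
  e.symm.isHodgeAt_hom_app_iff s p v

/-- **Transported form**: the determination `γ·(hom_s u)` at `t` is Hodge of level `p` iff the determination `γ·u` is. [cite: CattaniDeligneKaplan1995, §1]
[cite: VoisinHodgeI2002, §7.3.1] -/
theorem isHodgeAt_transport_hom_app_iff (e : Iso D₁ D₂) {s t : S} (γ : Path.Homotopic.Quotient s t) (p : ℤ) (u : D₁.VZ.fiber s) :
    D₂.IsHodgeAt t p (D₂.VZ.transport γ (e.hom.app s u)) ↔ D₁.IsHodgeAt t p (D₁.VZ.transport γ u) := by
  rw [← e.hom.app_transport, isHodgeAt_hom_app_iff]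

/-- **Hodge loci are invariant under isomorphisms**: the set of `t` at which some flat transport of `hom_s u` is a Hodge class of level `p` equals the set
of `t` at which some flat transport of `u` is. [cite: CattaniDeligneKaplan1995, §1] [cite: VoisinHodgeI2002, §7.3.1] -/
theorem setOf_exists_isHodgeAt_transport_eq (e : Iso D₁ D₂) (s : S) (p : ℤ) (u : D₁.VZ.fiber s) :
    {t | ∃ γ : Path.Homotopic.Quotient s t, D₂.IsHodgeAt t p (D₂.VZ.transport γ (e.hom.app s u))} =
      {t | ∃ γ : Path.Homotopic.Quotient s t, D₁.IsHodgeAt t p (D₁.VZ.transport γ u)} :=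
  Set.ext fun _ => exists_congr fun γ => e.isHodgeAt_transport_hom_app_iff γ p u

end Iso

/-! ## §3 Isometries and the norm-bounded Hodge loci -/

section Isometry

variable {D₁ D₂ D₃ : VHSData S k}

/-- **`φ` is an isometry**: on every rational fibre `Q₂(φ_ℚ x, φ_ℚ y) = Q₁(x, y)` (compatibility with the polarizations, which `Hom` does not require).
[cite: CattaniDeligneKaplan1995, §1] [cite: Schmid1973, §2] -/
def Hom.IsIsometry (φ : Hom D₁ D₂) : Prop :=
  ∀ (s : S) (x y : D₁.V.fiber s), (D₂.form s).form (φ.appRat s x) (φ.appRat s y) = (D₁.form s).form x y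

/-- An isometry preserves the form on integral vectors: `Q₂(φ u, φ v) = Q₁(u, v)`. [cite: CattaniDeligneKaplan1995, §1] -/
theorem Hom.IsIsometry.form_toRat_app {φ : Hom D₁ D₂} (hφ : φ.IsIsometry) (s : S) (u v : D₁.VZ.fiber s) :
    (D₂.form s).form (D₂.toRat s (φ.app s u)) (D₂.toRat s (φ.app s v)) = (D₁.form s).form (D₁.toRat s u) (D₁.toRat s v) := by
  rw [← φ.appRat_toRat, ← φ.appRat_toRat]
  exact hφ s _ _

/-- The identity is an isometry. [cite: Schmid1973, §2] -/
theorem Hom.isIsometry_id (D : VHSData S k) : (Hom.id D).IsIsometry := fun s x y => by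
  rw [Hom.appRat_id, LinearMap.id_apply, LinearMap.id_apply]

/-- Isometries compose. [cite: Schmid1973, §2] -/
theorem Hom.IsIsometry.comp {ψ : Hom D₂ D₃} {φ : Hom D₁ D₂} (hψ : ψ.IsIsometry) (hφ : φ.IsIsometry) : (ψ.comp φ).IsIsometry := fun s x y => by
  rw [Hom.appRat_comp, LinearMap.comp_apply, LinearMap.comp_apply, hψ, hφ]

/-- The inverse of an isometric isomorphism is an isometry. [cite: Schmid1973, §2] -/
theorem Iso.isIsometry_inv (e : Iso D₁ D₂) (he : e.hom.IsIsometry) : e.inv.IsIsometry := fun s x y => by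
  rw [← he s (e.inv.appRat s x) (e.inv.appRat s y), e.hom_appRat_inv_appRat, e.hom_appRat_inv_appRat]

/-- **An injective isometry maps the norm-bounded Hodge locus into the norm-bounded Hodge locus**: a nonzero Hodge class `u` of level `p` with
`Q₁(u,u) ≤ K` goes to the nonzero Hodge class `φ u` of level `p` with `Q₂(φ u, φ u) = Q₁(u, u) ≤ K`. [cite: CattaniDeligneKaplan1995, §1, Thm 1.1] -/
theorem Hom.hodgeLocusOfNormLe_subset_of_isIsometry (φ : Hom D₁ D₂) (hφ : φ.IsIsometry) (hinj : ∀ s, Function.Injective (φ.app s)) (p K : ℤ) :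
    D₁.hodgeLocusOfNormLe p K ⊆ D₂.hodgeLocusOfNormLe p K := by
  rintro s ⟨u, hu0, hu, hK⟩
  refine ⟨φ.app s u, fun h => hu0 (hinj s (h.trans (map_zero (φ.app s)).symm)), φ.isHodgeAt_app hu, ?_⟩
  rw [hφ.form_toRat_app]
  exact hK

/-- **The norm-bounded Hodge loci are invariant under isometric isomorphisms of VHS data.** [cite: CattaniDeligneKaplan1995, §1, Thm 1.1] -/
theorem Iso.hodgeLocusOfNormLe_eq (e : Iso D₁ D₂) (he : e.hom.IsIsometry) (p K : ℤ) : D₁.hodgeLocusOfNormLe p K = D₂.hodgeLocusOfNormLe p K :=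
  Set.Subset.antisymm (e.hom.hodgeLocusOfNormLe_subset_of_isIsometry he e.hom_app_injective p K)
    (e.inv.hodgeLocusOfNormLe_subset_of_isIsometry (e.isIsometry_inv he) e.symm.hom_app_injective p K)

end Isometry

/-! ## §4 Functoriality of isomorphisms under the tensor operations; the structural isomorphisms of the Tate twist -/

namespace Iso

variable {k₁ k₂ : ℤ} {D₁ D₁' : VHSData S k₁} {D₂ D₂' : VHSData S k₂} {D D' : VHSData S k}

/-- **`e₁ ⊗ e₂ : D₁ ⊗ D₂ ≅ D₁' ⊗ D₂'`.** [cite: DeligneMilne1982Tannakian, §1] [cite: Deligne1970, I.1] -/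
def tensor (e₁ : Iso D₁ D₁') (e₂ : Iso D₂ D₂') : Iso (D₁.tensor D₂) (D₁'.tensor D₂') where
  hom := e₁.hom.tensor e₂.hom
  inv := e₁.inv.tensor e₂.inv
  inv_comp_hom := by rw [← Hom.tensor_comp, e₁.inv_comp_hom, e₂.inv_comp_hom, Hom.tensor_id]
  hom_comp_inv := by rw [← Hom.tensor_comp, e₁.hom_comp_inv, e₂.hom_comp_inv, Hom.tensor_id]

/-- `(e₁ ⊗ e₂).hom = e₁.hom ⊗ e₂.hom`. [cite: Deligne1970, I.1] -/
@[simp] theorem tensor_hom (e₁ : Iso D₁ D₁') (e₂ : Iso D₂ D₂') : (e₁.tensor e₂).hom = e₁.hom.tensor e₂.hom := rfl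

/-- `(e₁ ⊗ e₂).inv = e₁.inv ⊗ e₂.inv`. [cite: Deligne1970, I.1] -/
@[simp] theorem tensor_inv (e₁ : Iso D₁ D₁') (e₂ : Iso D₂ D₂') : (e₁.tensor e₂).inv = e₁.inv.tensor e₂.inv := rfl

/-- **`e^∨ : D^∨ ≅ D'^∨`** (forward map the transpose of `e.inv`). [cite: DeligneMilne1982Tannakian, §1] [cite: Deligne1970, I.1] -/
def dual (e : Iso D D') : Iso D.dual D'.dual where
  hom := e.inv.dualMap
  inv := e.hom.dualMap
  inv_comp_hom := by rw [← Hom.dualMap_comp, e.inv_comp_hom, Hom.dualMap_id]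
  hom_comp_inv := by rw [← Hom.dualMap_comp, e.hom_comp_inv, Hom.dualMap_id]

/-- `e^∨.hom = (e.inv)^∨`. [cite: Deligne1970, I.1] -/
@[simp] theorem dual_hom (e : Iso D D') : e.dual.hom = e.inv.dualMap := rfl

/-- `e^∨.inv = (e.hom)^∨`. [cite: Deligne1970, I.1] -/
@[simp] theorem dual_inv (e : Iso D D') : e.dual.inv = e.hom.dualMap := rfl

/-- **`e(j) : D(j) ≅ D'(j)`.** [cite: DeligneHodgeII1971, 2.1.14] -/
def tateTwist (e : Iso D D') (j : ℤ) : Iso (D.tateTwist j) (D'.tateTwist j) where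
  hom := e.hom.tateTwist j
  inv := e.inv.tateTwist j
  inv_comp_hom := by rw [← Hom.tateTwist_comp, e.inv_comp_hom, Hom.tateTwist_id]
  hom_comp_inv := by rw [← Hom.tateTwist_comp, e.hom_comp_inv, Hom.tateTwist_id]

/-- `e(j).hom = e.hom(j)`. [cite: DeligneHodgeII1971, 2.1.14] -/
@[simp] theorem tateTwist_hom (e : Iso D D') (j : ℤ) : (e.tateTwist j).hom = e.hom.tateTwist j := rfl

/-- **`e.castMap h : D.cast h ≅ D'.cast h`.** [cite: DeligneHodgeII1971, 2.1.14] -/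
def castMap (e : Iso D D') (h : k = k') : Iso (D.cast h) (D'.cast h) where
  hom := e.hom.castMap h
  inv := e.inv.castMap h
  inv_comp_hom := by rw [← Hom.castMap_comp, e.inv_comp_hom, Hom.castMap_id]
  hom_comp_inv := by rw [← Hom.castMap_comp, e.hom_comp_inv, Hom.castMap_id]

/-- `(e.castMap h).hom = e.hom.castMap h`. [cite: DeligneHodgeII1971, 2.1.14] -/
@[simp] theorem castMap_hom (e : Iso D D') (h : k = k') : (e.castMap h).hom = e.hom.castMap h := rfl

/-- **`e₁ ⊕ e₂ : D₁ ⊕ D₂ ≅ D₁' ⊕ D₂'`** (same weight). [cite: DeligneHodgeII1971, 2.1] [cite: Deligne1970, I.1] -/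
def prod {D₁ D₁' D₂ D₂' : VHSData S k} (e₁ : Iso D₁ D₁') (e₂ : Iso D₂ D₂') : Iso (D₁.prod D₂) (D₁'.prod D₂') where
  hom := e₁.hom.prodMap e₂.hom
  inv := e₁.inv.prodMap e₂.inv
  inv_comp_hom := by rw [Hom.prodMap_comp_prodMap, e₁.inv_comp_hom, e₂.inv_comp_hom, Hom.prodMap_id]
  hom_comp_inv := by rw [Hom.prodMap_comp_prodMap, e₁.hom_comp_inv, e₂.hom_comp_inv, Hom.prodMap_id]

/-- `(e₁ ⊕ e₂).hom = e₁.hom ⊕ e₂.hom`. [cite: DeligneHodgeII1971, 2.1] -/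
@[simp] theorem prod_hom {D₁ D₁' D₂ D₂' : VHSData S k} (e₁ : Iso D₁ D₁') (e₂ : Iso D₂ D₂') : (e₁.prod e₂).hom = e₁.hom.prodMap e₂.hom := rfl

/-- **`D(0) ≅ D`** (the structural morphisms `Hom.tateTwistZero ∕ ofTateTwistZero` of `Motives/FamiliesVHSTateTwist`, packaged; target cast from weight `k`
to `k − 2·0`). [cite: DeligneHodgeII1971, 2.1.14] -/
def tateTwistZero (D : VHSData S k) : Iso (D.tateTwist 0) (D.cast (by ring : k = k - 2 * 0)) where
  hom := Hom.tateTwistZero D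
  inv := Hom.ofTateTwistZero D
  inv_comp_hom := Hom.ofTateTwistZero_comp_tateTwistZero D
  hom_comp_inv := Hom.tateTwistZero_comp_ofTateTwistZero D

/-- **`D(i)(j) ≅ D(i+j)`** (the structural morphisms `Hom.tateTwistAdd ∕ ofTateTwistAdd`, packaged). [cite: DeligneHodgeII1971, 2.1.14] -/
def tateTwistAdd (D : VHSData S k) (i j : ℤ) : Iso ((D.tateTwist i).tateTwist j) ((D.tateTwist (i + j)).cast (by ring : k - 2 * (i + j) = k - 2 * i - 2 * j)) where
  hom := Hom.tateTwistAdd D i j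
  inv := Hom.ofTateTwistAdd D i j
  inv_comp_hom := Hom.ofTateTwistAdd_comp_tateTwistAdd D i j
  hom_comp_inv := Hom.tateTwistAdd_comp_ofTateTwistAdd D i j

/-- The Tate-twist isomorphisms are isometries (the forms of `D(j)` are those of `D`). [cite: DeligneHodgeII1971, 2.1.14] -/
theorem isIsometry_tateTwistZero_hom (D : VHSData S k) : (tateTwistZero D).hom.IsIsometry := fun s x y => by
  change ((D.form s).form) (D.homRat D s LinearMap.id x) (D.homRat D s LinearMap.id y) = (D.form s).form x y
  rw [homRat_id, LinearMap.id_apply, LinearMap.id_apply]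

/-- `D(i)(j) ≅ D(i+j)` is an isometry. [cite: DeligneHodgeII1971, 2.1.14] -/
theorem isIsometry_tateTwistAdd_hom (D : VHSData S k) (i j : ℤ) : (tateTwistAdd D i j).hom.IsIsometry := fun s x y => by
  change ((D.form s).form) (D.homRat D s LinearMap.id x) (D.homRat D s LinearMap.id y) = (D.form s).form x y
  rw [homRat_id, LinearMap.id_apply, LinearMap.id_apply]

/-- Hence `hodgeLocusOfNormLe` of `D(i)(j)` is that of `D(i+j)` (and of `D`). [cite: CattaniDeligneKaplan1995, §1, Thm 1.1] -/
theorem hodgeLocusOfNormLe_tateTwist_tateTwist (D : VHSData S k) (i j : ℤ) (p K : ℤ) :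
    ((D.tateTwist i).tateTwist j).hodgeLocusOfNormLe p K = (D.tateTwist (i + j)).hodgeLocusOfNormLe p K :=
  (tateTwistAdd D i j).hodgeLocusOfNormLe_eq (isIsometry_tateTwistAdd_hom D i j) p K

end Iso

end VHSData

end Literature.AlgebraicGeometry.Motives

end
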